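import Mathlib.Analysis.Calculus.ContDiff.Basic
import Mathlib.Analysis.Calculus.ParametricIntegral
import Mathlib.MeasureTheory.Integral.Bochner.Set
import Literature.Analysis.FluidPDE.SpaceTimeCalculus
import HarnessLib

/-!
# Space–time calculus for jointly `C¹` fields: slices, the one-sided time derivative,
# differentiation under the integral sign

Analysis/FluidPDE support file (folklore calculus; first consumer: the discharge of
`Literature.Barriers.AtomisticToContinuum.ShockFormationBarrier`, Sideris 1985, Thm. 1, whose
solutions are only `C¹` in space–time).

The tree's space–time dictionary (`ClassicalSolutionCalculus`, `SpaceTimeCalculus`,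
`EnergyToolkit`) is written for jointly *smooth* fields `Fluid.IsSmoothSpaceTimeOn S w`
(`uncurry w` is `C^∞` on `S ×ˢ univ`). This file is the `C¹` (more generally `Cⁿ`) analogue for a
field `w : ℝ → X → F` with `ContDiffOn ℝ n (uncurry w) (S ×ˢ univ)`:

* slices `w t`, `t ∈ S`, are `Cⁿ` (`contDiff_slice_of_contDiffOn`), time lines are continuous on
  `S`;
* at interior times (`S ∈ 𝓝 t`): the time line `s ↦ w s x` has the two-sided derivative
  `timeDerivWithin S w t x = D(uncurry w)(t, x)(1, 0)` (`hasDerivAt_timeLine_timeDerivWithin`);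
* on a time set of unique differentiability (e.g. `Ici 0`, `Icc 0 T`): the slice derivative and
  the one-sided time derivative are restrictions of the joint `fderivWithin`, hence
  `(t, x) ↦ D(w t)(x)` and `(t, x) ↦ timeDerivWithin S w t x` are continuous on `S ×ˢ univ`
  (`continuousOn_fderiv_slice_of_contDiffOn`, `continuousOn_timeDerivWithin_of_contDiffOn`);
* **differentiation under the integral sign** for a jointly `C¹` integrand with slices supported
  in a fixed compact set, on an open time set (`hasDerivAt_integral_of_contDiffOn`), the `C¹`
  counterpart of `hasDerivAt_integral_of_support_subset`.

## Mathlib search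

Thin layer over Mathlib (`ContDiffOn.comp_contDiff`, `ContDiffOn.contDiffAt`,
`ContDiffOn.continuousOn_fderivWithin`, `UniqueDiffOn.prod`,
`hasDerivAt_integral_of_dominated_loc_of_deriv_le`) and the tree's `hasFDerivAt_slice`,
`hasDerivAt_timeLine`, `hasFDerivAt_slice_of_hasFDerivWithinAt`,
`hasDerivWithinAt_timeLine_of_hasFDerivWithinAt` (`SpaceTimeCalculus`); Mathlib has no curried
("slice") statements (searched `uncurry` in `Analysis/Calculus/ContDiff`). No definitions.

## References

* L. C. Evans, *Partial Differential Equations*, 2nd ed. (2010), App. C.1–C.2, §7.1.2 (b).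
* T. C. Sideris, Comm. Math. Phys. 101 (1985) 475–485, §1 (`C¹` solutions).
-/

noncomputable section

open MeasureTheory Set Function Filter Topology

namespace Literature.Analysis.FluidPDE

section Slices

variable {X : Type*} [NormedAddCommGroup X] [NormedSpace ℝ X]
variable {F : Type*} [NormedAddCommGroup F] [NormedSpace ℝ F]
variable {w : ℝ → X → F} {S : Set ℝ} {t : ℝ} {n : WithTop ℕ∞}

/-- A jointly `Cⁿ` field has `Cⁿ` time slices `w t`, `t ∈ S` (compose with `x ↦ (t, x)`;
Evans, *PDE*, App. C.1). [folklore] -/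
theorem contDiff_slice_of_contDiffOn (hw : ContDiffOn ℝ n (uncurry w) (S ×ˢ univ)) (ht : t ∈ S) :
    ContDiff ℝ n (w t) := by
  have hc : ContDiff ℝ n (fun x : X => ((t, x) : ℝ × X)) := contDiff_const.prodMk contDiff_id
  have := hw.comp_contDiff hc (fun x => mk_mem_prod ht (mem_univ x))
  simpa [Function.comp_def] using this

/-- The time lines `s ↦ w s x` of a jointly `Cⁿ` field are continuous on `S`. [folklore] -/
theorem continuousOn_timeLine_of_contDiffOn (hw : ContDiffOn ℝ n (uncurry w) (S ×ˢ univ))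
    (x : X) : ContinuousOn (fun s => w s x) S :=
  hw.continuousOn.comp (continuous_id.prodMk continuous_const).continuousOn
    (fun _ hs => mk_mem_prod hs (mem_univ x))

/-- At an interior time (`S ∈ 𝓝 t`) a jointly `C¹` field is differentiable at `(t, x)`. [folklore] -/
theorem hasFDerivAt_uncurry_of_contDiffOn (hw : ContDiffOn ℝ 1 (uncurry w) (S ×ˢ univ))
    (ht : S ∈ 𝓝 t) (x : X) :
    HasFDerivAt (uncurry w) (fderiv ℝ (uncurry w) (t, x)) (t, x) := by
  have hmem : S ×ˢ (univ : Set X) ∈ 𝓝 (t, x) := prod_mem_nhds ht univ_mem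
  exact ((hw.contDiffAt hmem).differentiableAt one_ne_zero).hasFDerivAt

/-- At an interior time the time line `s ↦ w s x` of a jointly `C¹` field has the two-sided
derivative `D(uncurry w)(t, x)(1, 0)`. [folklore] -/
theorem hasDerivAt_timeLine_of_contDiffOn (hw : ContDiffOn ℝ 1 (uncurry w) (S ×ˢ univ))
    (ht : S ∈ 𝓝 t) (x : X) :
    HasDerivAt (fun s => w s x) (fderiv ℝ (uncurry w) (t, x) (1, 0)) t :=
  hasDerivAt_timeLine (hasFDerivAt_uncurry_of_contDiffOn hw ht x)

/-- At an interior time the one-sided time derivative is the two-sided one: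
`timeDerivWithin S w t x = D(uncurry w)(t, x)(1, 0)`. [folklore] -/
theorem timeDerivWithin_eq_fderiv_of_contDiffOn (hw : ContDiffOn ℝ 1 (uncurry w) (S ×ˢ univ))
    (ht : S ∈ 𝓝 t) (x : X) :
    timeDerivWithin S w t x = fderiv ℝ (uncurry w) (t, x) (1, 0) := by
  rw [timeDerivWithin_apply, derivWithin_of_mem_nhds ht]
  exact (hasDerivAt_timeLine_of_contDiffOn hw ht x).deriv

/-- At an interior time the time line has derivative `timeDerivWithin S w t x` (the form in
which evolution equations written with `timeDerivWithin` are used at `t ∈ interior S`). [folklore] -/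
theorem hasDerivAt_timeLine_timeDerivWithin (hw : ContDiffOn ℝ 1 (uncurry w) (S ×ˢ univ))
    (ht : S ∈ 𝓝 t) (x : X) :
    HasDerivAt (fun s => w s x) (timeDerivWithin S w t x) t := by
  rw [timeDerivWithin_eq_fderiv_of_contDiffOn hw ht x]
  exact hasDerivAt_timeLine_of_contDiffOn hw ht x

/-- At an interior time the slice `w t` has derivative `D(uncurry w)(t, x) ∘ (0, ·)` at `x`. [folklore] -/
theorem hasFDerivAt_slice_of_contDiffOn (hw : ContDiffOn ℝ 1 (uncurry w) (S ×ˢ univ))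
    (ht : S ∈ 𝓝 t) (x : X) :
    HasFDerivAt (w t) ((fderiv ℝ (uncurry w) (t, x)).comp (ContinuousLinearMap.inr ℝ ℝ X)) x :=
  hasFDerivAt_slice (hasFDerivAt_uncurry_of_contDiffOn hw ht x)

/-! ### Time sets of unique differentiability (closed slabs, half-lines) -/

/-- On a time set of unique differentiability, a jointly `C¹` field has, at every `(t, x)` with
`t ∈ S`, the joint derivative `fderivWithin ℝ (uncurry w) (S ×ˢ univ) (t, x)` within
`S ×ˢ univ`. [folklore] -/
theorem hasFDerivWithinAt_uncurry_of_contDiffOn (hw : ContDiffOn ℝ 1 (uncurry w) (S ×ˢ univ))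
    (ht : t ∈ S) (x : X) :
    HasFDerivWithinAt (uncurry w) (fderivWithin ℝ (uncurry w) (S ×ˢ univ) (t, x)) (S ×ˢ univ)
      (t, x) :=
  ((hw (t, x) (mk_mem_prod ht (mem_univ x))).differentiableWithinAt one_ne_zero).hasFDerivWithinAt

/-- The slice derivative is the restriction of the joint one-sided derivative:
`D(w t)(x) = D_{S × X}(uncurry w)(t, x) ∘ (0, ·)` for `t ∈ S`. [folklore] -/
theorem fderiv_slice_eq_of_contDiffOn (hw : ContDiffOn ℝ 1 (uncurry w) (S ×ˢ univ))
    (ht : t ∈ S) (x : X) :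
    fderiv ℝ (w t) x =
      (fderivWithin ℝ (uncurry w) (S ×ˢ univ) (t, x)).comp (ContinuousLinearMap.inr ℝ ℝ X) :=
  (hasFDerivAt_slice_of_hasFDerivWithinAt (hasFDerivWithinAt_uncurry_of_contDiffOn hw ht x) ht).fderiv

/-- The one-sided time derivative is the restriction of the joint one-sided derivative:
`timeDerivWithin S w t x = D_{S × X}(uncurry w)(t, x)(1, 0)` for `t ∈ S`, `S` of unique
differentiability. [folklore] -/
theorem timeDerivWithin_eq_fderivWithin_of_contDiffOn (hw : ContDiffOn ℝ 1 (uncurry w) (S ×ˢ univ))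
    (hS : UniqueDiffOn ℝ S) (ht : t ∈ S) (x : X) :
    timeDerivWithin S w t x = fderivWithin ℝ (uncurry w) (S ×ˢ univ) (t, x) (1, 0) :=
  (hasDerivWithinAt_timeLine_of_hasFDerivWithinAt
    (hasFDerivWithinAt_uncurry_of_contDiffOn hw ht x)).derivWithin (hS t ht)

/-- For `t ∈ S` (unique differentiability) the time line has the one-sided derivative
`timeDerivWithin S w t x` within `S`. [folklore] -/
theorem hasDerivWithinAt_timeLine_of_contDiffOn (hw : ContDiffOn ℝ 1 (uncurry w) (S ×ˢ univ))
    (hS : UniqueDiffOn ℝ S) (ht : t ∈ S) (x : X) :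
    HasDerivWithinAt (fun s => w s x) (timeDerivWithin S w t x) S t := by
  rw [timeDerivWithin_eq_fderivWithin_of_contDiffOn hw hS ht x]
  exact hasDerivWithinAt_timeLine_of_hasFDerivWithinAt
    (hasFDerivWithinAt_uncurry_of_contDiffOn hw ht x)

/-- **Joint continuity of the slice derivative** of a jointly `C¹` field on a time set of unique
differentiability: `(t, x) ↦ D(w t)(x)` is continuous on `S ×ˢ univ`. [folklore] -/
theorem continuousOn_fderiv_slice_of_contDiffOn (hw : ContDiffOn ℝ 1 (uncurry w) (S ×ˢ univ))
    (hS : UniqueDiffOn ℝ S) :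
    ContinuousOn (fun p : ℝ × X => fderiv ℝ (w p.1) p.2) (S ×ˢ univ) := by
  have hc : ContinuousOn (fderivWithin ℝ (uncurry w) (S ×ˢ univ)) (S ×ˢ univ) :=
    hw.continuousOn_fderivWithin (hS.prod uniqueDiffOn_univ) le_rfl
  have hcomp : ContinuousOn (fun p : ℝ × X =>
      (fderivWithin ℝ (uncurry w) (S ×ˢ univ) p).comp (ContinuousLinearMap.inr ℝ ℝ X))
      (S ×ˢ univ) :=
    ((ContinuousLinearMap.compL ℝ X (ℝ × X) F).flip
      (ContinuousLinearMap.inr ℝ ℝ X)).continuous.comp_continuousOn hc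
  refine hcomp.congr fun p hp => ?_
  rcases p with ⟨t, x⟩
  exact fderiv_slice_eq_of_contDiffOn hw (mem_prod.1 hp).1 x

/-- **Joint continuity of the one-sided time derivative** of a jointly `C¹` field on a time set
of unique differentiability: `(t, x) ↦ timeDerivWithin S w t x` is continuous on `S ×ˢ univ`. [folklore] -/
theorem continuousOn_timeDerivWithin_of_contDiffOn (hw : ContDiffOn ℝ 1 (uncurry w) (S ×ˢ univ))
    (hS : UniqueDiffOn ℝ S) :
    ContinuousOn (fun p : ℝ × X => timeDerivWithin S w p.1 p.2) (S ×ˢ univ) := by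
  have hc : ContinuousOn (fderivWithin ℝ (uncurry w) (S ×ˢ univ)) (S ×ˢ univ) :=
    hw.continuousOn_fderivWithin (hS.prod uniqueDiffOn_univ) le_rfl
  have happ : ContinuousOn (fun p : ℝ × X => fderivWithin ℝ (uncurry w) (S ×ˢ univ) p (1, 0))
      (S ×ˢ univ) := hc.clm_apply continuousOn_const
  refine happ.congr fun p hp => ?_
  rcases p with ⟨t, x⟩
  exact timeDerivWithin_eq_fderivWithin_of_contDiffOn hw hS (mem_prod.1 hp).1 x

/-- Joint continuity of a slice-derivative *applied to a jointly continuous field*: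
`(t, x) ↦ D(w t)(x) (v t x)` is continuous on `S ×ˢ univ`. [folklore] -/
theorem continuousOn_fderiv_slice_apply_of_contDiffOn
    (hw : ContDiffOn ℝ 1 (uncurry w) (S ×ˢ univ)) (hS : UniqueDiffOn ℝ S) {v : ℝ → X → X}
    (hv : ContinuousOn (uncurry v) (S ×ˢ univ)) :
    ContinuousOn (fun p : ℝ × X => fderiv ℝ (w p.1) p.2 (v p.1 p.2)) (S ×ˢ univ) :=
  (continuousOn_fderiv_slice_of_contDiffOn hw hS).clm_apply hv

end Slices

/-! ### Differentiation under the integral sign for jointly `C¹` integrands -/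

section Parametric

variable {X : Type*} [NormedAddCommGroup X] [NormedSpace ℝ X] [MeasurableSpace X]
  [OpensMeasurableSpace X]
variable {F : Type*} [NormedAddCommGroup F] [NormedSpace ℝ F]
variable {μ : Measure X} [IsLocallyFiniteMeasure μ]

/-- **Differentiation under the integral sign, `C¹` integrands.** If `Φ` is jointly `C¹` on an
open time set `S` and the slices `Φ t`, `t ∈ S`, are supported in a fixed compact set `K`, then
for `t ∈ S`, `d/dt ∫ Φ t x ∂μ = ∫ ∂ₜΦ(t, x) ∂μ` (Mathlib
`hasDerivAt_integral_of_dominated_loc_of_deriv_le`, dominated on a compact time-neighbourhood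
by the maximum of the continuous `∂ₜΦ = D(uncurry Φ)(·)(1, 0)` on `[t - δ, t + δ] × K`; Evans,
*PDE*, §7.1.2 (b)). The smooth version is `hasDerivAt_integral_of_support_subset`. [folklore] -/
theorem hasDerivAt_integral_of_contDiffOn [CompleteSpace F] [SecondCountableTopologyEither X F]
    {Φ : ℝ → X → F} {S : Set ℝ}
    (hS : IsOpen S) (hΦ : ContDiffOn ℝ 1 (uncurry Φ) (S ×ˢ univ)) {K : Set X} (hK : IsCompact K)
    (hsupp : ∀ t ∈ S, ∀ x ∉ K, Φ t x = 0) {t : ℝ} (ht : t ∈ S) :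
    HasDerivAt (fun s => ∫ x, Φ s x ∂μ) (∫ x, deriv (fun s => Φ s x) t ∂μ) t := by
  -- a compact time-neighbourhood `[t - δ/2, t + δ/2] ⊆ S`
  obtain ⟨δ, hδ, hball⟩ := Metric.isOpen_iff.1 hS t ht
  have hIcc : Icc (t - δ / 2) (t + δ / 2) ⊆ S := fun s hs => hball <| by
    rw [Metric.mem_ball, Real.dist_eq, abs_lt]
    constructor <;> linarith [hs.1, hs.2]
  have hnhds : Icc (t - δ / 2) (t + δ / 2) ∈ 𝓝 t := Icc_mem_nhds (by linarith) (by linarith)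
  -- the time derivative field: at interior points it is `D(uncurry Φ)(s, x)(1, 0)`
  set Φ' : ℝ → X → F := fun s x => deriv (fun r => Φ r x) s with hΦ'
  have hderiv : ∀ s ∈ S, ∀ x, HasDerivAt (fun r => Φ r x) (Φ' s x) s := fun s hs x =>
    (hasDerivAt_timeLine_of_contDiffOn hΦ (hS.mem_nhds hs) x).differentiableAt.hasDerivAt
  have hΦ'eq : ∀ p ∈ S ×ˢ (univ : Set X), uncurry Φ' p = fderiv ℝ (uncurry Φ) p (1, 0) := by
    rintro ⟨s, x⟩ hp
    exact (hasDerivAt_timeLine_of_contDiffOn hΦ (hS.mem_nhds (mem_prod.1 hp).1) x).deriv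
  have hΦ'cont : ContinuousOn (uncurry Φ') (S ×ˢ univ) := by
    have h1 : ContinuousOn (fun p : ℝ × X => fderiv ℝ (uncurry Φ) p (1, 0)) (S ×ˢ univ) :=
      (hΦ.continuousOn_fderiv_of_isOpen (hS.prod isOpen_univ) le_rfl).clm_apply
        continuousOn_const
    exact h1.congr hΦ'eq
  -- slices are continuous
  have hslice : ∀ s ∈ S, Continuous (Φ s) := fun s hs =>
    (contDiff_slice_of_contDiffOn hΦ hs).continuous
  have hslice' : ∀ s ∈ S, Continuous (Φ' s) := fun s hs =>
    hΦ'cont.comp_continuous (continuous_const.prodMk continuous_id)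
      fun x => mk_mem_prod hs (mem_univ x)
  -- `Φ' s x = 0` off `K`
  have hsupp' : ∀ s ∈ S, ∀ x ∉ K, Φ' s x = 0 := by
    intro s hs x hx
    have : (fun r => Φ r x) =ᶠ[𝓝 s] fun _ => (0 : F) := by
      filter_upwards [hS.mem_nhds hs] with r hr using hsupp r hr x hx
    show deriv (fun r => Φ r x) s = 0
    rw [this.deriv_eq, deriv_const]
  -- a uniform bound for `Φ'` on `[t - δ/2, t + δ/2] × K`
  obtain ⟨M, hM⟩ : ∃ M, ∀ z ∈ Icc (t - δ / 2) (t + δ / 2) ×ˢ K, ‖uncurry Φ' z‖ ≤ M :=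
    (isCompact_Icc.prod hK).exists_bound_of_continuousOn
      (hΦ'cont.mono (prod_mono hIcc (subset_univ _)))
  -- dominated differentiation
  have key := hasDerivAt_integral_of_dominated_loc_of_deriv_le (μ := μ) (F := Φ) (F' := Φ')
    (x₀ := t) (bound := K.indicator fun _ => M) hnhds ?_ ?_ ?_ ?_ ?_ ?_
  · exact key.2
  · filter_upwards [hS.mem_nhds ht] with s hs using (hslice s hs).aestronglyMeasurable
  · exact (hslice t ht).integrable_of_hasCompactSupport (HasCompactSupport.intro hK (hsupp t ht))
  · exact (hslice' t ht).aestronglyMeasurable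
  · refine Eventually.of_forall fun x s hs => ?_
    by_cases hx : x ∈ K
    · rw [indicator_of_mem hx]
      exact hM (s, x) (mk_mem_prod hs hx)
    · rw [indicator_of_notMem hx, hsupp' s (hIcc hs) x hx, norm_zero]
  · exact (integrable_indicator_iff hK.measurableSet).2
      (integrableOn_const hK.measure_lt_top.ne)
  · exact Eventually.of_forall fun x s hs => hderiv s (hIcc hs) x

/-- The same statement with the derivative written as `∫ D(uncurry Φ)(t, x)(1, 0) ∂μ`. [folklore] -/
theorem hasDerivAt_integral_of_contDiffOn' [CompleteSpace F] [SecondCountableTopologyEither X F]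
    {Φ : ℝ → X → F} {S : Set ℝ}
    (hS : IsOpen S) (hΦ : ContDiffOn ℝ 1 (uncurry Φ) (S ×ˢ univ)) {K : Set X} (hK : IsCompact K)
    (hsupp : ∀ t ∈ S, ∀ x ∉ K, Φ t x = 0) {t : ℝ} (ht : t ∈ S) :
    HasDerivAt (fun s => ∫ x, Φ s x ∂μ) (∫ x, fderiv ℝ (uncurry Φ) (t, x) (1, 0) ∂μ) t := by
  have h := hasDerivAt_integral_of_contDiffOn (μ := μ) hS hΦ hK hsupp ht
  have heq : (fun x => deriv (fun s => Φ s x) t) = fun x => fderiv ℝ (uncurry Φ) (t, x) (1, 0) :=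
    funext fun x => (hasDerivAt_timeLine_of_contDiffOn hΦ (hS.mem_nhds ht) x).deriv
  rwa [heq] at h

end Parametric

end Literature.Analysis.FluidPDE

end
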